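import Mathlib.LinearAlgebra.UnitaryGroup
import Mathlib.Data.Matrix.Basis
import Mathlib.Data.Matrix.PEquiv
import Mathlib.Analysis.Complex.Basic
import HarnessLib

/-!
# Test unitaries for the conjugation action of `U(N)` on `M_N(ℂ)`: diagonal phases, permutation matrices, and the mixing unitary `((1+i)·1 + (1−i)·P_τ)/2`

HONEST FRAMING: exact (Metropolis-corrected) sampling algorithms for lattice gauge theory;
figures of merit are autocorrelation/cost numbers at stated couplings and volumes; no
continuum-physics claim.

Venture `LatticeQCDFlow` (cell pub-lqcd), sub-topic `Scoring`; FANOUT row 5 (`s0-sun-a`), GEN-20.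
NEW WORK of the cell (placement rule).  Elementary matrix facts (Mathlib-only) used by `AdConjugationCommutant` (Schur's lemma
for `X ↦ uXu*`, the first input of the exact second moment of 2-d Wilson loops): the diagonal phase `diag(1,…,i,…,1)` and
the permutation matrices `P_σ = σ.toPEquiv.toMatrix` are unitary, conjugation by them rescales / permutes the matrix units
`Matrix.single j k 1`, the transposition matrix `P_τ` (`τ = (p q)`) is a self-adjoint involution with
`E_{pp}P_τ = E_{pq}`, `P_τE_{pp} = E_{qp}`, `P_τE_{pp}P_τ = E_{qq}`, and `u = ((1+i)/2)·1 + ((1−i)/2)·P_τ` is unitary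
(`mixing_mem_unitaryGroup`); `exists_perm_pair`: the symmetric group is doubly transitive.  No `def`, nothing cited as a
fact, 0 sorry.
-/

noncomputable section

open Matrix Complex

namespace Summit.Ventures.LatticeQCDFlow.Scoring

section TestUnitaries

variable {N : ℕ}

/-- The diagonal phase `diag(1, …, i, …, 1)` (an `i` at position `k`) is unitary. -/
theorem diagonal_phase_mem_unitaryGroup (k : Fin N) :
    (Matrix.diagonal fun a : Fin N => if a = k then (I : ℂ) else 1) ∈ Matrix.unitaryGroup (Fin N) ℂ := by
  rw [Matrix.mem_unitaryGroup_iff, Matrix.star_eq_conjTranspose, Matrix.diagonal_conjTranspose,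
    Matrix.diagonal_mul_diagonal, ← Matrix.diagonal_one]
  congr 1
  funext a
  by_cases h : a = k
  · simp [h, Complex.conj_I]
  · simp [h]

/-- `i ≠ 1` in `ℂ` (real parts). -/
theorem I_ne_one' : (I : ℂ) ≠ 1 := by
  intro h; have := congrArg Complex.re h; simp at this

/-- `i ≠ −i` in `ℂ` (imaginary parts). -/
theorem I_ne_neg_I' : (I : ℂ) ≠ -I := by
  intro h; have := congrArg Complex.im h; norm_num at this

/-- `−i ≠ 1` in `ℂ` (real parts). -/
theorem neg_I_ne_one' : (-I : ℂ) ≠ 1 := by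
  intro h; have := congrArg Complex.re h; simp at this

/-- The adjoint of a permutation matrix is the matrix of the inverse permutation. -/
theorem star_perm_toMatrix (σ : Equiv.Perm (Fin N)) :
    star (σ.toPEquiv.toMatrix : Matrix (Fin N) (Fin N) ℂ) = σ.symm.toPEquiv.toMatrix := by
  ext a b
  rw [Matrix.star_apply, PEquiv.toMatrix_toPEquiv_apply, PEquiv.toMatrix_toPEquiv_apply, Pi.single_apply,
    Pi.single_apply]
  by_cases h : a = σ b
  · rw [if_pos h, if_pos ((Equiv.eq_symm_apply σ).2 h.symm), star_one]
  · rw [if_neg h, if_neg (fun e => h ((Equiv.eq_symm_apply σ).1 e).symm), star_zero]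

/-- Permutation matrices are unitary. -/
theorem perm_toMatrix_mem_unitaryGroup (σ : Equiv.Perm (Fin N)) :
    (σ.toPEquiv.toMatrix : Matrix (Fin N) (Fin N) ℂ) ∈ Matrix.unitaryGroup (Fin N) ℂ := by
  rw [Matrix.mem_unitaryGroup_iff, star_perm_toMatrix, ← PEquiv.toMatrix_trans, ← Equiv.toPEquiv_trans,
    Equiv.self_trans_symm, Equiv.toPEquiv_refl, PEquiv.toMatrix_refl]

/-- Conjugation by a permutation matrix permutes rows and columns: `(P_σ X P_σ*)_{ab} = X_{σa, σb}`. -/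
theorem perm_conj_eq_submatrix (σ : Equiv.Perm (Fin N)) (X : Matrix (Fin N) (Fin N) ℂ) :
    (σ.toPEquiv.toMatrix : Matrix (Fin N) (Fin N) ℂ) * X * star (σ.toPEquiv.toMatrix : Matrix (Fin N) (Fin N) ℂ)
      = X.submatrix σ σ := by
  rw [star_perm_toMatrix, PEquiv.toMatrix_toPEquiv_mul, PEquiv.mul_toMatrix_toPEquiv, Equiv.symm_symm]
  rfl

/-- A permutation carrying the ordered pair `(j', k')` to `(j, k)` (`j ≠ k`, `j' ≠ k'`). -/
theorem exists_perm_pair {j k j' k' : Fin N} (hjk : j ≠ k) (hjk' : j' ≠ k') :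
    ∃ σ : Equiv.Perm (Fin N), σ.symm j = j' ∧ σ.symm k = k' := by
  set τ : Equiv.Perm (Fin N) := Equiv.swap j' j with hτ
  have hτj : τ j' = j := Equiv.swap_apply_left _ _
  have hτk : τ k' ≠ j := by
    intro h
    have : k' = j' := τ.injective (h.trans hτj.symm)
    exact hjk' this.symm
  refine ⟨Equiv.swap k (τ k') * τ, ?_, ?_⟩
  · rw [Equiv.symm_apply_eq]
    show j = Equiv.swap k (τ k') (τ j')
    rw [hτj, Equiv.swap_apply_of_ne_of_ne hjk hτk.symm]
  · rw [Equiv.symm_apply_eq]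
    show k = Equiv.swap k (τ k') (τ k')
    rw [Equiv.swap_apply_right]

/-- Expansion of `(a·1 + b·P) E (a'·1 + b'·P)`. -/
theorem smul_one_add_smul_mul_mul (a b a' b' : ℂ) (P E : Matrix (Fin N) (Fin N) ℂ) :
    (a • (1 : Matrix (Fin N) (Fin N) ℂ) + b • P) * E * (a' • (1 : Matrix (Fin N) (Fin N) ℂ) + b' • P)
      = (a * a') • E + (a * b') • (E * P) + (b * a') • (P * E) + (b * b') • (P * E * P) := by
  simp only [add_mul, mul_add, smul_mul_assoc, mul_smul_comm, one_mul, mul_one, smul_add, smul_smul]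
  rw [mul_comm a' a, mul_comm b' a, mul_comm a' b, mul_comm b' b]
  abel

/-- The transposition matrix is self-adjoint. -/
theorem star_swap_toMatrix (p q : Fin N) :
    star ((Equiv.swap p q).toPEquiv.toMatrix : Matrix (Fin N) (Fin N) ℂ) = (Equiv.swap p q).toPEquiv.toMatrix := by
  rw [star_perm_toMatrix, Equiv.symm_swap]

/-- The transposition matrix is an involution. -/
theorem swap_toMatrix_mul_self (p q : Fin N) :
    ((Equiv.swap p q).toPEquiv.toMatrix : Matrix (Fin N) (Fin N) ℂ) * (Equiv.swap p q).toPEquiv.toMatrix = 1 := by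
  rw [← PEquiv.toMatrix_trans, ← Equiv.toPEquiv_trans]
  have h : (Equiv.swap p q).trans (Equiv.swap p q) = Equiv.refl _ := by
    calc (Equiv.swap p q).trans (Equiv.swap p q) = (Equiv.swap p q).symm.trans (Equiv.swap p q) := by
          rw [Equiv.symm_swap]
      _ = Equiv.refl _ := Equiv.symm_trans_self _
  rw [h, Equiv.toPEquiv_refl, PEquiv.toMatrix_refl]

/-- Left multiplication by the transposition matrix swaps two rows: `(P_τ X)_{ab} = X_{τa, b}`. -/
theorem swap_toMatrix_mul_apply (p q : Fin N) (X : Matrix (Fin N) (Fin N) ℂ) (a b : Fin N) :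
    (((Equiv.swap p q).toPEquiv.toMatrix : Matrix (Fin N) (Fin N) ℂ) * X) a b = X (Equiv.swap p q a) b := by
  rw [PEquiv.toMatrix_toPEquiv_mul]; rfl

/-- Right multiplication by the transposition matrix swaps two columns: `(X P_τ)_{ab} = X_{a, τb}`. -/
theorem mul_swap_toMatrix_apply (p q : Fin N) (X : Matrix (Fin N) (Fin N) ℂ) (a b : Fin N) :
    (X * ((Equiv.swap p q).toPEquiv.toMatrix : Matrix (Fin N) (Fin N) ℂ)) a b = X a (Equiv.swap p q b) := by
  rw [PEquiv.mul_toMatrix_toPEquiv, Equiv.symm_swap]; rfl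

/-- `E_{pp} P_τ = E_{pq}` for `τ = (p q)`. -/
theorem single_mul_swap (p q : Fin N) :
    Matrix.single p p (1 : ℂ) * (Equiv.swap p q).toPEquiv.toMatrix = Matrix.single p q 1 := by
  ext a b
  rw [mul_swap_toMatrix_apply, Matrix.single_apply, Matrix.single_apply]
  by_cases hb : b = q
  · subst hb; simp [Equiv.swap_apply_right]
  · have h1 : Equiv.swap p q b ≠ p := by
      intro h
      have := (Equiv.swap_apply_eq_iff).1 h
      rw [Equiv.swap_apply_left] at this
      exact hb this
    simp [Ne.symm h1, Ne.symm hb]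

/-- `P_τ E_{pp} = E_{qp}` for `τ = (p q)`. -/
theorem swap_mul_single (p q : Fin N) :
    ((Equiv.swap p q).toPEquiv.toMatrix : Matrix (Fin N) (Fin N) ℂ) * Matrix.single p p (1 : ℂ) = Matrix.single q p 1 := by
  ext a b
  rw [swap_toMatrix_mul_apply, Matrix.single_apply, Matrix.single_apply]
  by_cases ha : a = q
  · subst ha; simp [Equiv.swap_apply_right]
  · have h1 : Equiv.swap p q a ≠ p := by
      intro h
      have := (Equiv.swap_apply_eq_iff).1 h
      rw [Equiv.swap_apply_left] at this
      exact ha this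
    simp [Ne.symm h1, Ne.symm ha]

/-- `P_τ E_{pp} P_τ = E_{qq}` for `τ = (p q)`. -/
theorem swap_mul_single_mul_swap (p q : Fin N) :
    ((Equiv.swap p q).toPEquiv.toMatrix : Matrix (Fin N) (Fin N) ℂ) * Matrix.single p p (1 : ℂ) *
      (Equiv.swap p q).toPEquiv.toMatrix = Matrix.single q q 1 := by
  rw [swap_mul_single]
  ext a b
  rw [mul_swap_toMatrix_apply, Matrix.single_apply, Matrix.single_apply]
  by_cases hb : b = q
  · subst hb; simp [Equiv.swap_apply_right]
  · have h1 : Equiv.swap p q b ≠ p := by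
      intro h
      have := (Equiv.swap_apply_eq_iff).1 h
      rw [Equiv.swap_apply_left] at this
      exact hb this
    simp [Ne.symm h1, Ne.symm hb]

/-- The mixing matrix `u = ((1+i)/2)·1 + ((1−i)/2)·P_τ` is unitary. -/
theorem mixing_mem_unitaryGroup (p q : Fin N) :
    ((1 + I) / 2) • (1 : Matrix (Fin N) (Fin N) ℂ) + ((1 - I) / 2) • (Equiv.swap p q).toPEquiv.toMatrix
      ∈ Matrix.unitaryGroup (Fin N) ℂ := by
  rw [Matrix.mem_unitaryGroup_iff, star_add, star_smul, star_smul, star_one, star_swap_toMatrix]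
  have e1 : (star ((1 + I) / 2) : ℂ) = (1 - I) / 2 := by
    rw [Complex.star_def, map_div₀, map_add, map_one, Complex.conj_I, map_ofNat]; ring
  have e2 : (star ((1 - I) / 2) : ℂ) = (1 + I) / 2 := by
    rw [Complex.star_def, map_div₀, map_sub, map_one, Complex.conj_I, map_ofNat]; ring
  rw [e1, e2, ← mul_one (((1 + I) / 2) • (1 : Matrix (Fin N) (Fin N) ℂ) + ((1 - I) / 2) • (Equiv.swap p q).toPEquiv.toMatrix),
    smul_one_add_smul_mul_mul]
  simp only [one_mul, mul_one]
  rw [swap_toMatrix_mul_self]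
  have c1 : (1 + I) / 2 * ((1 - I) / 2) = (1 / 2 : ℂ) := by ring_nf; rw [Complex.I_sq]; ring
  have c2 : (1 + I) / 2 * ((1 + I) / 2) = (I / 2 : ℂ) := by ring_nf; rw [Complex.I_sq]; ring
  have c3 : (1 - I) / 2 * ((1 - I) / 2) = (-(I / 2) : ℂ) := by ring_nf; rw [Complex.I_sq]; ring
  have c4 : (1 - I) / 2 * ((1 + I) / 2) = (1 / 2 : ℂ) := by ring_nf; rw [Complex.I_sq]; ring
  rw [c1, c2, c3, c4]
  ext a b
  simp only [Matrix.add_apply, Matrix.smul_apply, smul_eq_mul, Matrix.one_apply]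
  split_ifs <;> ring

end TestUnitaries

end Summit.Ventures.LatticeQCDFlow.Scoring
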